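import Literature.NumberTheory.GaloisCohomology.Howard2004.InertLocalTauProofs
import Literature.NumberTheory.GaloisCohomology.Howard2004.DualityDatumIsotropy
import Literature.NumberTheory.GaloisRepresentations.ContinuousCupProductCompat
import HarnessLib

/-!
# Howard 2004, §1.3: the local pairing `⟨ , ⟩_λ` at an inert prime is SYMMETRIC (residual level) —
# `⟨x, y⟩_q = x ∪_P τ_q y` for the skew pairing `P(s,t) = ē(s, θ t)`, and the swap rule on `τ_q`-eigenclasses

Topic `NumberTheory/GaloisCohomology/Howard2004`. THEOREMS ONLY: no definition, no named fact, no
instance, no notation, no `sorry`. Cell `pub/bsd-print-x9`, print leaf G87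
`Literature.NumberTheory.GaloisCohomology.Howard2004.thm161_dvrKolyvaginBound` (Howard Thm. 1.6.1);
seat `bsd-line-x10b-p1-w5` g8, continuing the Lemma 1.5.3 («parity») chain of g7
(`IsotropicLineParity` §6 asks, for the «elementary linear algebra exercise», the cross-term
`B u v + B v u ≠ 0` on `τ`-eigenLINES; this file and its sequel `InertLocalPairingInvarianceProofs`
supply the Galois side: symmetry of `⟨ , ⟩_q` and `H¹(K_q, T̄)⁺ ⊥ H¹(K_q, T̄)⁻`).

SOURCE. B. Howard, *The Heegner point Kolyvagin system*, Compositio Math. **140** (2004) =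
arXiv:1202.6340. §1.3 (p. 8 L4–6): «When hypothesis H.4 holds, it can be shown the local pairing
`H¹(K_λ, T) × H¹(K_λ, T) → R` at any degree two prime `λ` of `K` is symmetric.» Rem. 1.3.2 (p. 8 L13–22):
«the pairing `(s,t) = e(s, t^τ)` … the composition `H¹(K_v̄, T) → H¹(K_v, Tw(T)) → H¹(K_v, T)` is the usual
action of complex conjugation. Using this identification the local pairing of H.4 is exactly the usual local
Tate pairing … the existence of a pairing of the type described in H.4 is equivalent to the existence of a
skew-symmetric, Galois-equivariant pairing.» H.5(c) (p. 7 L98 – p. 8 L1): «the residual pairing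
`T̄ × T̄ → (R/𝔪)(1)` satisfies `(s^τ, t^τ) = (s,t)^τ`». Lemma 1.5.3 (p. 10 L10–16, L34–40).

DICTIONARY. `Dbar : DualityDatum p cd ρbar R` = H.4 data on the residual `T̄` (`ResidualDualityDatumProofs`:
`exists_residualDualityDatum`, which also delivers `hθ : ē(θ x, θ y) = −ē(x, y)` = H.5(c));
`A : ResidualTau cd ρbar` = the `G_ℚ`-structure `θ` (H.5(a)); `P := Dbar.eHom.compl₂ A.θ`, `P(s,t) = ē(s, θ t)`;
`x ∪_P y` = the cup product `H¹(K_v, T̄) × H¹(K_v, T̄) → H²(K_v, R̄(1))` of the continuous pairing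
`DiscreteGaloisModule.pairing _ _ _ P (thetaPairing_equivariant_toLocal …)`; at an inert `q`
(`h : σ q = q`) `⟨x, y⟩_q := Dbar.localCup q x (transport_q (h.symm ▸ y))` (before `inv_q`) and
`τ_q y := θ_*(transport_q (h.symm ▸ y))` (`InertLocalTauProofs`).

WHAT IS PROVED.
* §1 `thetaPairing_equivariant` (`P` is `Γ_K`-invariant into `R̄(1)` for the ORIGINAL action on both
  factors), `thetaPairing_swap` (**`P(t,s) = −P(s,t)`** from `ē` symmetric + H.5(c)).
* §2 at any place `v`: **`localCup_eq_cupProduct_thetaH1`** (`x ∪_ē z = x ∪_P θ_* z`, equality of the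
  inhomogeneous cup-product cocycles) and **`cupProduct_thetaPairing_comm`** (`a ∪_P b = b ∪_P a`: graded
  commutativity `ContPairing.cupProduct_comm` + skewness).
* §3 at an inert `q`: **`localCup_transportH1_cast_eq_cupProduct`** (`⟨x, y⟩_q = x ∪_P τ_q y`);
  `localCup_transportH1_cast_of_eq` / `cupProduct_eq_neg_localCup_transportH1_cast_of_eq_neg`
  (`⟨x, y⟩_q = ±(x ∪_P y)` on `τ_q y = ±y`); **`localCup_transportH1_cast_comm_of_eq[_neg]`**
  (`⟨v, u⟩_q = ⟨u, v⟩_q` on two eigenclasses of the same sign — Howard's symmetry, sign by sign),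
  `…_comm_of_eq_of_eq_neg` (`⟨v, u⟩_q = −⟨u, v⟩_q` on opposite signs), and
  `localCup_transportH1_cast_add_swap_of_eq` (`⟨u, v⟩_q + ⟨v, u⟩_q = 2 • ⟨u, v⟩_q`: the cross-term of
  `Submodule.le_or_le_of_isotropic_of_eigen` is `2 ⟨u, v⟩_q`, so `hcross` ⟸ «`⟨u, v⟩_q ≠ 0` on the
  eigenlines», a consequence of local Tate duality on each eigenpart, see the sequel).

TYPING NOTE. `galoisCohomology ρ n` and Mathlib's `continuousCohomology n ρ.toTopRep` are definitionally
but not reducibly equal; statements put `−`/`+` only on `galoisCohomology`-typed leaves (`localCup`, classes)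
and proofs bridge by `exact` (never `rw`) across the two spellings.

NOT HERE: the `G_ℚ`-invariance `ι_q (τ_q x ∪_P τ_q y) = ι_q (x ∪_P y)` (sequel, hypothesis `hGQ`, proved
for `ConjugationDatum.ofLifts` in `InertLocalPairingOfLiftsProofs`), eigenLINES (H.5(a) at `q`), the
`SelmerStructure` bookkeeping; `thm161_dvrKolyvaginBound` is NOT proved; no summit statement is proved;
the Birch–Swinnerton-Dyer conjecture is not proved by any of this.
References: [Howard2004HeegnerKolyvagin] §1.3 H.4/H.5, Rem. 1.3.2, Lemma 1.5.3;
[NeukirchSchmidtWingberg2008] I §4 (1.4.4), (1.4.8); [SerreGaloisCohomology1997] I §2.4.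
-/

set_option autoImplicit false

noncomputable section

open Function NumberField IsDedekindDomain Field CategoryTheory
open scoped NumberField

namespace Literature.NumberTheory.GaloisCohomology.Howard2004

open Literature.NumberTheory.GaloisRepresentations
open Literature.NumberTheory.GaloisRepresentations.DiscreteGaloisModule
open Literature.NumberTheory.EllipticCurves

variable {K : Type} [Field K] [NumberField K] {Nbar : Type} [AddCommGroup Nbar]
  [TopologicalSpace Nbar] [DiscreteTopology Nbar] {R : Type} [CommRing R] [TopologicalSpace R]
  [DiscreteTopology R] [Module R Nbar] {p : ℕ} [Fact p.Prime] [Algebra ℤ_[p] R]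
  {cd : ConjugationDatum K} {ρbar : DiscreteGaloisModule K Nbar}

namespace DualityDatum

/-! ## §1 The pairing `P(s, t) = ē(s, θ t)` on `T̄`: `Γ_K`-invariant into `R(1)`, and skew -/

/-- **`P(s, t) := ē(s, θ t)` is a `Γ_K`-invariant pairing `T̄ × T̄ → R̄(1)`** (for the ORIGINAL action on
both factors): `ē(g s, θ(g t)) = ē(g s, g^τ (θ t)) = χ(g) ē(s, θ t)` by `θ ∘ ρ̄(g^τ) = ρ̄(g) ∘ θ` (H.5(a))
and the `Γ_K`-invariance of `ē : T̄ × Tw(T̄) → R̄(1)` (H.4).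
[cite: Howard2004HeegnerKolyvagin, §1.3 H.4 and Rem. 1.3.2 (arXiv p. 7 L69–80; p. 8 L13–22: «`(s,t) = e(s, t^τ)`»)] -/
theorem thetaPairing_equivariant (Dbar : DualityDatum p cd ρbar R) (A : ResidualTau (R := R) cd ρbar)
    (g : absoluteGaloisGroup K) (s t : Nbar) :
    Dbar.eHom.compl₂ A.θ.toAddMonoidHom (ρbar g s) (ρbar g t) =
      Dbar.twistOne g (Dbar.eHom.compl₂ A.θ.toAddMonoidHom s t) := by
  have hθ : A.θ (ρbar g t) = ρbar (cd.conj g) (A.θ t) := by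
    have h := A.compat g (A.θ t)
    rw [A.involutive] at h
    rw [← h, A.involutive]
  rw [AddMonoidHom.compl₂_apply, AddMonoidHom.compl₂_apply]
  change Dbar.eHom (ρbar g s) (A.θ (ρbar g t)) = Dbar.twistOne g (Dbar.eHom s (A.θ t))
  rw [hθ]
  exact Dbar.eHom_equivariant g s (A.θ t)

/-- The same at a place `v` (the local modules are restrictions). [cite: Howard2004HeegnerKolyvagin, §1.3 H.4 (arXiv p. 7 L74–80)] -/
theorem thetaPairing_equivariant_toLocal (Dbar : DualityDatum p cd ρbar R)
    (A : ResidualTau (R := R) cd ρbar) (v : Place K)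
    (g : absoluteGaloisGroup (Place.Completion v)) (s t : Nbar) :
    Dbar.eHom.compl₂ A.θ.toAddMonoidHom (ρbar.toLocal v g s) (ρbar.toLocal v g t) =
      Dbar.twistOne.toLocal v g (Dbar.eHom.compl₂ A.θ.toAddMonoidHom s t) :=
  Dbar.thetaPairing_equivariant A _ s t

/-- Unfolding: `P(s, t) = ē(s, θ t)`. [cite: Howard2004HeegnerKolyvagin, Rem. 1.3.2 (arXiv p. 8 L13–22)] -/
theorem thetaPairing_apply (Dbar : DualityDatum p cd ρbar R) (A : ResidualTau (R := R) cd ρbar)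
    (s t : Nbar) : Dbar.eHom.compl₂ A.θ.toAddMonoidHom s t = Dbar.e s (A.θ t) := rfl

/-- **`P` is skew: `P(t, s) = −P(s, t)`**, from the symmetry of `ē` (H.4) and H.5(c) in the form
`ē(θ x, θ y) = −ē(x, y)` («`(s^τ, t^τ) = (s,t)^τ`», `τ` acting on `(R/𝔪)(1)` by `−1`):
`ē(t, θ s) = ē(θ s, θ θ t) = −ē(s, θ t)`. (Howard, Rem. 1.3.2: «the existence of a pairing of the type
described in H.4 is equivalent to the existence of a skew-symmetric, Galois-equivariant pairing».)
[cite: Howard2004HeegnerKolyvagin, §1.3 H.5(c) and Rem. 1.3.2 (arXiv p. 7 L98 – p. 8 L1; p. 8 L19–22)] -/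
theorem thetaPairing_swap (Dbar : DualityDatum p cd ρbar R) (A : ResidualTau (R := R) cd ρbar)
    (hθ : ∀ x y : Nbar, Dbar.e (A.θ x) (A.θ y) = -Dbar.e x y) (s t : Nbar) :
    Dbar.eHom.compl₂ A.θ.toAddMonoidHom t s = -Dbar.eHom.compl₂ A.θ.toAddMonoidHom s t := by
  rw [thetaPairing_apply, thetaPairing_apply, Dbar.symm t (A.θ s)]
  conv_lhs => rw [← A.involutive t]
  exact hθ s (A.θ t)

/-! ## §2 Cup-product identities at a place `v`: `x ∪_ē z = x ∪_P θ_* z`, and `∪_P` is symmetric -/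

section Cup

variable (Dbar : DualityDatum p cd ρbar R) (A : ResidualTau (R := R) cd ρbar) (v : Place K)

/-- **Howard's local pairing through `P`: `x ∪_ē z = x ∪_P (θ_* z)`** for `x ∈ H¹(K_v, T̄)`,
`z ∈ H¹(K_v, Tw T̄)` — the two inhomogeneous cup-product `2`-cocycles `(σ, τ) ↦ ē(f σ, σ·_{Tw} g τ)` and
`(σ, τ) ↦ ē(f σ, θ(σ · θ(g τ)))` coincide (`θ ∘ ρ̄(σ) ∘ θ = ρ̄(σ^τ)`).
[cite: Howard2004HeegnerKolyvagin, §1.3 H.4 and Rem. 1.3.2 (arXiv p. 7 L78–82; p. 8 L13–22: «Using this identification the local pairing of H.4 is exactly the usual local Tate pairing»)]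
[cite: NeukirchSchmidtWingberg2008, I §4 (1.4.8)] -/
theorem localCup_eq_cupProduct_thetaH1 (x : galoisCohomology (ρbar.toLocal v) 1)
    (z : galoisCohomology ((cd.twist ρbar).toLocal v) 1) :
    Dbar.localCup v x z =
      haveI : CompactSpace (absoluteGaloisGroup (Place.Completion v)) := absoluteGaloisGroup_compactSpace _
      (DiscreteGaloisModule.pairing (ρbar.toLocal v) (ρbar.toLocal v) (Dbar.twistOne.toLocal v)
          (Dbar.eHom.compl₂ A.θ.toAddMonoidHom) (Dbar.thetaPairing_equivariant_toLocal A v)).cupProduct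
        x (A.thetaH1 v z) := by
  haveI : CompactSpace (absoluteGaloisGroup (Place.Completion v)) := absoluteGaloisGroup_compactSpace _
  obtain ⟨f, rfl⟩ := oneCocycleClass_surjective _ x
  obtain ⟨g, rfl⟩ := oneCocycleClass_surjective _ z
  have hθ : A.thetaH1 v (oneCocycleClass _ g) = oneCocycleClass _
      (contOneCocycles.pullback (ContinuousMonoidHom.id _)
        (X := ((cd.twist ρbar).toLocal v).toTopRep) (Y := (ρbar.toLocal v).toTopRep)
        (TopRep.ofHom ⟨⟨A.θ.toAddMonoidHom.toIntLinearMap, continuous_of_discreteTopology⟩,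
          fun g => ContinuousLinearMap.ext fun x =>
            A.compat (absGaloisRestrict K (Place.Completion v) g) x⟩) g) :=
    map_oneCocycleClass _ _ _ g
  rw [hθ, Dbar.localCup_oneCocycleClass, ContPairing.cupProduct_oneCocycleClass_eq_twoCocycleClass]
  congr 1
  refine Subtype.ext (ContinuousMap.ext fun q => ?_)
  obtain ⟨σ, τ⟩ := q
  rw [ContPairing.cupCocycle_apply_eq_smul, ContPairing.cupCocycle_apply_eq_smul,
    contOneCocycles.pullback_apply]
  change Dbar.e (f.1 σ) (ρbar (cd.conj (absGaloisRestrict K (Place.Completion v) σ)) (g.1 τ)) =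
    Dbar.e (f.1 σ) (A.θ (ρbar (absGaloisRestrict K (Place.Completion v) σ) (A.θ (g.1 τ))))
  rw [← A.compat, A.involutive]

/-- **`∪_P` is symmetric on `H¹(K_v, T̄)`: `a ∪_P b = b ∪_P a`** — graded commutativity of the cup product
in bidegree `(1,1)` (`a ∪ b = −(b ∪' a)`, `ContPairing.cupProduct_comm`) and skewness of `P`
(`∪' = −∪`). This is Howard's remark «when H.4 holds … the local pairing
`H¹(K_λ, T) × H¹(K_λ, T) → R` at any degree two prime `λ` of `K` is symmetric», at the residual level.
[cite: Howard2004HeegnerKolyvagin, §1.3 (arXiv p. 8 L4–6) and Prop. 1.4.3's «flippity» (p. 9 L60–62)]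
[cite: NeukirchSchmidtWingberg2008, I §4 (1.4.4)] -/
theorem cupProduct_thetaPairing_comm (hθ : ∀ x y : Nbar, Dbar.e (A.θ x) (A.θ y) = -Dbar.e x y)
    (a b : galoisCohomology (ρbar.toLocal v) 1) :
    haveI : CompactSpace (absoluteGaloisGroup (Place.Completion v)) := absoluteGaloisGroup_compactSpace _
    (DiscreteGaloisModule.pairing (ρbar.toLocal v) (ρbar.toLocal v) (Dbar.twistOne.toLocal v)
          (Dbar.eHom.compl₂ A.θ.toAddMonoidHom) (Dbar.thetaPairing_equivariant_toLocal A v)).cupProduct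
        a b =
      (DiscreteGaloisModule.pairing (ρbar.toLocal v) (ρbar.toLocal v) (Dbar.twistOne.toLocal v)
          (Dbar.eHom.compl₂ A.θ.toAddMonoidHom) (Dbar.thetaPairing_equivariant_toLocal A v)).cupProduct
        b a := by
  haveI : CompactSpace (absoluteGaloisGroup (Place.Completion v)) := absoluteGaloisGroup_compactSpace _
  set P := DiscreteGaloisModule.pairing (ρbar.toLocal v) (ρbar.toLocal v) (Dbar.twistOne.toLocal v)
    (Dbar.eHom.compl₂ A.θ.toAddMonoidHom) (Dbar.thetaPairing_equivariant_toLocal A v) with hP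
  obtain ⟨f, rfl⟩ := oneCocycleClass_surjective _ a
  obtain ⟨g, rfl⟩ := oneCocycleClass_surjective _ b
  rw [P.cupProduct_comm, ContPairing.cupProduct_oneCocycleClass_eq_twoCocycleClass,
    ContPairing.cupProduct_oneCocycleClass_eq_twoCocycleClass, ← twoCocycleClass_neg]
  congr 1
  refine Subtype.ext (ContinuousMap.ext fun q => ?_)
  obtain ⟨σ, τ⟩ := q
  rw [Submodule.coe_neg, ContinuousMap.neg_apply, ContPairing.cupCocycle_apply,
    ContPairing.cupCocycle_apply]
  change -(Dbar.eHom.compl₂ A.θ.toAddMonoidHom (f.1 (σ * τ) - f.1 σ) (g.1 σ)) =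
    Dbar.eHom.compl₂ A.θ.toAddMonoidHom (g.1 σ) (f.1 (σ * τ) - f.1 σ)
  rw [Dbar.thetaPairing_swap A hθ (g.1 σ) (f.1 (σ * τ) - f.1 σ), neg_neg]

end Cup

/-! ## §3 At an INERT prime `q = σ q`: `⟨x, y⟩_q = x ∪_P τ_q y`, and the swap rule on `τ_q`-eigenclasses -/

section Inert

variable (Dbar : DualityDatum p cd ρbar R) (A : ResidualTau (R := R) cd ρbar)
  {q : HeightOneSpectrum (𝓞 K)} (h : cd.σ • q = q)

/-- **`⟨x, y⟩_q = x ∪_P τ_q y` at an inert prime** (before `inv_q`): Howard's local pairing of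
`x ∈ H¹(K_q, T̄)` with the transport of `y ∈ H¹(K_q̄, T̄) = H¹(K_q, T̄)` (place cast `h : σ q = q`) is the
cup product for `P(s,t) = ē(s, θ t)` of `x` with `τ_q y = θ_*(transport_q y)` (the local complex
conjugation of `InertLocalTauProofs`). [cite: Howard2004HeegnerKolyvagin, §1.3 H.4, Rem. 1.3.2 and Lemma 1.5.3 (arXiv p. 7 L78–82; p. 8 L13–22; p. 10 L12–16)] -/
theorem localCup_transportH1_cast_eq_cupProduct (x y : galoisCohomology (ρbar.toLocal (Sum.inr q)) 1) :
    Dbar.localCup (Sum.inr q) x (cd.transportH1 ρbar q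
        (h.symm ▸ y : galoisCohomology (ρbar.toLocal (Sum.inr (cd.σ • q))) 1)) =
      haveI : CompactSpace (absoluteGaloisGroup (Place.Completion (Sum.inr q : Place K))) :=
        absoluteGaloisGroup_compactSpace _
      (DiscreteGaloisModule.pairing (ρbar.toLocal (Sum.inr q)) (ρbar.toLocal (Sum.inr q))
          (Dbar.twistOne.toLocal (Sum.inr q)) (Dbar.eHom.compl₂ A.θ.toAddMonoidHom)
          (Dbar.thetaPairing_equivariant_toLocal A (Sum.inr q))).cupProduct x
        (A.thetaH1 (Sum.inr q) (cd.transportH1 ρbar q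
          (h.symm ▸ y : galoisCohomology (ρbar.toLocal (Sum.inr (cd.σ • q))) 1))) :=
  Dbar.localCup_eq_cupProduct_thetaH1 A (Sum.inr q) x _

/-- `⟨x, y⟩_q = x ∪_P y` for a `τ_q`-FIXED class `y`. [cite: Howard2004HeegnerKolyvagin, Lemma 1.5.3 (arXiv p. 10 L12–16: the `+`-eigenspaces)] -/
theorem localCup_transportH1_cast_of_eq {x y : galoisCohomology (ρbar.toLocal (Sum.inr q)) 1}
    (hy : A.thetaH1 (Sum.inr q) (cd.transportH1 ρbar q
        (h.symm ▸ y : galoisCohomology (ρbar.toLocal (Sum.inr (cd.σ • q))) 1)) = y) :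
    Dbar.localCup (Sum.inr q) x (cd.transportH1 ρbar q
        (h.symm ▸ y : galoisCohomology (ρbar.toLocal (Sum.inr (cd.σ • q))) 1)) =
      haveI : CompactSpace (absoluteGaloisGroup (Place.Completion (Sum.inr q : Place K))) :=
        absoluteGaloisGroup_compactSpace _
      (DiscreteGaloisModule.pairing (ρbar.toLocal (Sum.inr q)) (ρbar.toLocal (Sum.inr q))
          (Dbar.twistOne.toLocal (Sum.inr q)) (Dbar.eHom.compl₂ A.θ.toAddMonoidHom)
          (Dbar.thetaPairing_equivariant_toLocal A (Sum.inr q))).cupProduct x y := by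
  rw [Dbar.localCup_transportH1_cast_eq_cupProduct A h, hy]

/-- `x ∪_P y = −⟨x, y⟩_q` for a `τ_q`-ANTI-FIXED class `y`. [cite: Howard2004HeegnerKolyvagin, Lemma 1.5.3 (arXiv p. 10 L12–16: the `−`-eigenspaces)] -/
theorem cupProduct_eq_neg_localCup_transportH1_cast_of_eq_neg
    {x y : galoisCohomology (ρbar.toLocal (Sum.inr q)) 1}
    (hy : A.thetaH1 (Sum.inr q) (cd.transportH1 ρbar q
        (h.symm ▸ y : galoisCohomology (ρbar.toLocal (Sum.inr (cd.σ • q))) 1)) = -y) :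
    haveI : CompactSpace (absoluteGaloisGroup (Place.Completion (Sum.inr q : Place K))) :=
        absoluteGaloisGroup_compactSpace _
    (DiscreteGaloisModule.pairing (ρbar.toLocal (Sum.inr q)) (ρbar.toLocal (Sum.inr q))
          (Dbar.twistOne.toLocal (Sum.inr q)) (Dbar.eHom.compl₂ A.θ.toAddMonoidHom)
          (Dbar.thetaPairing_equivariant_toLocal A (Sum.inr q))).cupProduct x y =
      -Dbar.localCup (Sum.inr q) x (cd.transportH1 ρbar q
        (h.symm ▸ y : galoisCohomology (ρbar.toLocal (Sum.inr (cd.σ • q))) 1)) := by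
  haveI : CompactSpace (absoluteGaloisGroup (Place.Completion (Sum.inr q : Place K))) :=
    absoluteGaloisGroup_compactSpace _
  set P := DiscreteGaloisModule.pairing (ρbar.toLocal (Sum.inr q)) (ρbar.toLocal (Sum.inr q))
    (Dbar.twistOne.toLocal (Sum.inr q)) (Dbar.eHom.compl₂ A.θ.toAddMonoidHom)
    (Dbar.thetaPairing_equivariant_toLocal A (Sum.inr q)) with hP
  have h1 := Dbar.localCup_transportH1_cast_eq_cupProduct A h x y
  rw [hy] at h1
  -- `⟨x, y⟩_q = P x (−y) = −P x y`
  have h2 : Dbar.localCup (Sum.inr q) x (cd.transportH1 ρbar q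
      (h.symm ▸ y : galoisCohomology (ρbar.toLocal (Sum.inr (cd.σ • q))) 1)) = -P.cupProduct x y :=
    h1.trans ((P.cupProduct x).map_neg y)
  rw [h2]
  exact (neg_neg _).symm

/-- **Symmetry of `⟨ , ⟩_q` on a pair of `τ_q`-eigenclasses of the SAME sign: `⟨v, u⟩_q = ⟨u, v⟩_q`**
(`⟨u, v⟩_q = ε (u ∪_P v)`, `⟨v, u⟩_q = ε (v ∪_P u)` and `∪_P` is symmetric). With `ε = ±`: this is the
case of Howard's Lemma 1.5.3 where both classes lie in `H¹(K_λ, T̄)^±`; in particular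
`⟨u, v⟩_q + ⟨v, u⟩_q = 2 ⟨u, v⟩_q`, the shape of the cross-term `B u v + B v u` of the «elementary linear
algebra exercise» (`Submodule.le_or_le_of_isotropic_of_eigen`).
[cite: Howard2004HeegnerKolyvagin, §1.3 (arXiv p. 8 L4–6: «the local pairing … at any degree two prime … is symmetric») and Lemma 1.5.3 (p. 10 L34–40)] -/
theorem localCup_transportH1_cast_comm_of_eq (hθ : ∀ x y : Nbar, Dbar.e (A.θ x) (A.θ y) = -Dbar.e x y)
    {u v : galoisCohomology (ρbar.toLocal (Sum.inr q)) 1}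
    (hu : A.thetaH1 (Sum.inr q) (cd.transportH1 ρbar q
        (h.symm ▸ u : galoisCohomology (ρbar.toLocal (Sum.inr (cd.σ • q))) 1)) = u)
    (hv : A.thetaH1 (Sum.inr q) (cd.transportH1 ρbar q
        (h.symm ▸ v : galoisCohomology (ρbar.toLocal (Sum.inr (cd.σ • q))) 1)) = v) :
    Dbar.localCup (Sum.inr q) v (cd.transportH1 ρbar q
        (h.symm ▸ u : galoisCohomology (ρbar.toLocal (Sum.inr (cd.σ • q))) 1)) =
      Dbar.localCup (Sum.inr q) u (cd.transportH1 ρbar q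
        (h.symm ▸ v : galoisCohomology (ρbar.toLocal (Sum.inr (cd.σ • q))) 1)) := by
  rw [Dbar.localCup_transportH1_cast_of_eq A h hu, Dbar.localCup_transportH1_cast_of_eq A h hv,
    Dbar.cupProduct_thetaPairing_comm A (Sum.inr q) hθ]

/-- The same for two `τ_q`-ANTI-fixed classes: `⟨v, u⟩_q = ⟨u, v⟩_q`. [cite: Howard2004HeegnerKolyvagin, §1.3 (arXiv p. 8 L4–6) and Lemma 1.5.3 (p. 10 L34–40)] -/
theorem localCup_transportH1_cast_comm_of_eq_neg
    (hθ : ∀ x y : Nbar, Dbar.e (A.θ x) (A.θ y) = -Dbar.e x y)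
    {u v : galoisCohomology (ρbar.toLocal (Sum.inr q)) 1}
    (hu : A.thetaH1 (Sum.inr q) (cd.transportH1 ρbar q
        (h.symm ▸ u : galoisCohomology (ρbar.toLocal (Sum.inr (cd.σ • q))) 1)) = -u)
    (hv : A.thetaH1 (Sum.inr q) (cd.transportH1 ρbar q
        (h.symm ▸ v : galoisCohomology (ρbar.toLocal (Sum.inr (cd.σ • q))) 1)) = -v) :
    Dbar.localCup (Sum.inr q) v (cd.transportH1 ρbar q
        (h.symm ▸ u : galoisCohomology (ρbar.toLocal (Sum.inr (cd.σ • q))) 1)) =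
      Dbar.localCup (Sum.inr q) u (cd.transportH1 ρbar q
        (h.symm ▸ v : galoisCohomology (ρbar.toLocal (Sum.inr (cd.σ • q))) 1)) := by
  rw [← neg_inj, ← Dbar.cupProduct_eq_neg_localCup_transportH1_cast_of_eq_neg A h hu,
    ← Dbar.cupProduct_eq_neg_localCup_transportH1_cast_of_eq_neg A h hv,
    Dbar.cupProduct_thetaPairing_comm A (Sum.inr q) hθ]

/-- **Anti-symmetry on eigenclasses of OPPOSITE signs: `⟨v, u⟩_q = −⟨u, v⟩_q`** (`τ_q u = u`,
`τ_q v = −v`). [cite: Howard2004HeegnerKolyvagin, §1.3 (arXiv p. 8 L4–6) and Lemma 1.5.3 (p. 10 L12–16)] -/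
theorem localCup_transportH1_cast_comm_of_eq_of_eq_neg
    (hθ : ∀ x y : Nbar, Dbar.e (A.θ x) (A.θ y) = -Dbar.e x y)
    {u v : galoisCohomology (ρbar.toLocal (Sum.inr q)) 1}
    (hu : A.thetaH1 (Sum.inr q) (cd.transportH1 ρbar q
        (h.symm ▸ u : galoisCohomology (ρbar.toLocal (Sum.inr (cd.σ • q))) 1)) = u)
    (hv : A.thetaH1 (Sum.inr q) (cd.transportH1 ρbar q
        (h.symm ▸ v : galoisCohomology (ρbar.toLocal (Sum.inr (cd.σ • q))) 1)) = -v) :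
    Dbar.localCup (Sum.inr q) v (cd.transportH1 ρbar q
        (h.symm ▸ u : galoisCohomology (ρbar.toLocal (Sum.inr (cd.σ • q))) 1)) =
      -Dbar.localCup (Sum.inr q) u (cd.transportH1 ρbar q
        (h.symm ▸ v : galoisCohomology (ρbar.toLocal (Sum.inr (cd.σ • q))) 1)) := by
  rw [Dbar.localCup_transportH1_cast_of_eq A h hu,
    ← Dbar.cupProduct_eq_neg_localCup_transportH1_cast_of_eq_neg A h hv,
    Dbar.cupProduct_thetaPairing_comm A (Sum.inr q) hθ]

/-- The cross-term of the «elementary linear algebra exercise» on same-sign eigenclasses: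
`⟨u, v⟩_q + ⟨v, u⟩_q = 2 • ⟨u, v⟩_q`. [cite: Howard2004HeegnerKolyvagin, Lemma 1.5.3 (arXiv p. 10 L34–40)] -/
theorem localCup_transportH1_cast_add_swap_of_eq
    (hθ : ∀ x y : Nbar, Dbar.e (A.θ x) (A.θ y) = -Dbar.e x y)
    {u v : galoisCohomology (ρbar.toLocal (Sum.inr q)) 1}
    (hu : A.thetaH1 (Sum.inr q) (cd.transportH1 ρbar q
        (h.symm ▸ u : galoisCohomology (ρbar.toLocal (Sum.inr (cd.σ • q))) 1)) = u)
    (hv : A.thetaH1 (Sum.inr q) (cd.transportH1 ρbar q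
        (h.symm ▸ v : galoisCohomology (ρbar.toLocal (Sum.inr (cd.σ • q))) 1)) = v) :
    Dbar.localCup (Sum.inr q) u (cd.transportH1 ρbar q
        (h.symm ▸ v : galoisCohomology (ρbar.toLocal (Sum.inr (cd.σ • q))) 1)) +
      Dbar.localCup (Sum.inr q) v (cd.transportH1 ρbar q
        (h.symm ▸ u : galoisCohomology (ρbar.toLocal (Sum.inr (cd.σ • q))) 1)) =
      2 • Dbar.localCup (Sum.inr q) u (cd.transportH1 ρbar q
        (h.symm ▸ v : galoisCohomology (ρbar.toLocal (Sum.inr (cd.σ • q))) 1)) := by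
  rw [Dbar.localCup_transportH1_cast_comm_of_eq A h hθ hu hv, two_nsmul]

end Inert

end DualityDatum

end Literature.NumberTheory.GaloisCohomology.Howard2004
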